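import Summits.HubbardSuperconductivity.HubbardSuperconductivity.Theorems.AnisotropyChordDoobJohnsonChordDefs
import Summits.HubbardSuperconductivity.HubbardSuperconductivity.Theorems.AnisotropyChordBipartiteClassFunction
import Literature.Probability.LatticeModels.TorusBipartite
import Literature.MathematicalPhysics.QuantumLattice.SpinChainsLiebMattisProofs

/-!
# Route `AnisotropyChord`, crux `ChordXY` (stmt-HubbardSuperconductivity-8146), line `doob-johnson-chord`:
# the PERRON CONDENSATE of the sector and the PLAN-LAYER REDUCTIONS (landed from the lead skeleton)

Vocabulary of `…Theorems.AnisotropyChordDoobJohnsonChordDefs` (`Config`, `Hxxz`, `Otot`, `lam`, `IsGS`,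
`ofReal`, `field`).  This file lands, verbatim from the lead skeleton
`Cruxes/ChordXY/Lines/doob_johnson_chord.lean` (where they were proved but not importable), the
line's glue and plan layer:

* `sectorPerron_condensate` — for even `M` and every real `Δ` there is a REAL, entrywise NON-NEGATIVE,
  normalised `S^z_tot = 0` sector ground state `ψr` of `H_M(Δ)`, strictly positive wherever some sector
  vector lives, and every normalised sector ground state is a unit complex multiple of it
  (`xxz_sector_perron_pos`; Tasaki (2020) §2.4, Lieb–Wu (2003) §2);
* `lam_smul`, `lam_nonneg` (`Λ(aφ) = |a|²Λ(φ)`, `Λ = ‖S⁻_tot φ‖² ≥ 0`), `sum_sq_mul_field_self`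
  (`E_{ψ²}[g_ψ] = Λ(ψ)`), `norm_sq_ofReal`, `norm_sq_eq_of_phase`;
* `frozenFieldChord_of_ratioAntitone`, `frozenFieldChord_of_localRatioAntitone` — the frozen-field
  RATIO ANTITONICITY `(1+s)E_{p_t}[g_Δ] ≤ (1+t)E_{p_s}[g_Δ]` (globally on `Δ ≤ s ≤ t ≤ 0`, resp. locally
  for `t − s ≤ δ`), taken as an EXPLICIT HYPOTHESIS (no `def`), implies the registered hardest stub
  `stub_frozenFieldChord` (the local form by chaining along an equally spaced partition of the pencil
  with Perron states at the nodes).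

Folklore / bookkeeping; no definition is introduced; sorry-free.  HONEST: reductions only — the
hypotheses FFRA / LFFRA are open research statements; nothing here proves `ChordXY`; superconductivity
in the Hubbard model is not advanced.
-/

set_option linter.dupNamespace false

noncomputable section

namespace Summit.HubbardSuperconductivity.HubbardSuperconductivity.Theorems.AnisotropyChord.DoobJohnsonChord

open Matrix Finset
open Literature.MathematicalPhysics.QuantumLattice Literature.Probability.LatticeModels
open Summit.HubbardSuperconductivity.HubbardSuperconductivity.Theorems.AnisotropyChord
  (xxz_sector_perron_pos)

/-! ### Perron–Frobenius condensate of the sector -/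

/-- Every weight `W ≤ M²` is attained by a configuration (indicator of a `W`-subset). [folklore] -/
theorem exists_config_weight (M : ℕ) [NeZero M] (W : ℕ) (hW : W ≤ M ^ 2) :
    ∃ σ : Config M, (∑ z, (σ z : ℕ)) = W := by
  obtain ⟨T, -, hT⟩ := Finset.exists_subset_card_eq (s := (Finset.univ : Finset (TorusSite 2 M)))
    (n := W) (by
      rw [Finset.card_univ, show Fintype.card (TorusSite 2 M) = M ^ 2 by simp [Fintype.card_pi, ZMod.card]]
      exact hW)
  refine ⟨fun z => if z ∈ T then 1 else 0, ?_⟩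
  have h : ∀ z : TorusSite 2 M, (((if z ∈ T then 1 else 0 : Fin 2) : ℕ)) = if z ∈ T then 1 else 0 := by
    intro z
    split_ifs <;> rfl
  simp only [h]
  rw [Finset.sum_ite_mem, Finset.univ_inter, Finset.sum_const, smul_eq_mul, mul_one, hT]

/-- `⟨aφ, aφ⟩ = |a|² ⟨φ, φ⟩`. [folklore] -/
theorem star_smul_dotProduct_smul {ι : Type*} [Fintype ι] (a : ℂ) (v w : ι → ℂ) :
    star (a • v) ⬝ᵥ (a • w) = ((‖a‖ ^ 2 : ℝ) : ℂ) * (star v ⬝ᵥ w) := by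
  rw [star_smul, smul_dotProduct, dotProduct_smul, smul_smul, smul_eq_mul, Complex.star_def,
    Complex.conj_mul']
  push_cast
  ring

/-- Phase covariance of `Λ`: `Λ(aφ) = |a|² Λ(φ)`. [folklore] -/
theorem lam_smul (M : ℕ) [NeZero M] (a : ℂ) (φ : Config M → ℂ) :
    lam M (a • φ) = ‖a‖ ^ 2 * lam M φ := by
  unfold lam
  rw [mulVec_smul, star_smul_dotProduct_smul, Complex.re_ofReal_mul]

/-- **Perron–Frobenius condensate of the `S^z_tot = 0` sector** (even `M`, every real `Δ`): there is a
REAL, entrywise NON-NEGATIVE, normalised sector ground state `ψr` of `H_M(Δ)`, strictly positive at every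
configuration where some sector vector is non-zero, and every normalised sector ground state is a unit
complex multiple of it.  From `xxz_sector_perron_pos` (Tasaki (2020) §2.4; Lieb–Wu (2003) §2). [folklore] -/
theorem sectorPerron_condensate (M : ℕ) [NeZero M] (hM : Even M) (Δ : ℝ) :
    ∃ ψr : Config M → ℝ,
      (∀ σ, 0 ≤ ψr σ) ∧ IsGS M Δ (ofReal M ψr) ∧
      (∀ φ : Config M → ℂ, φ ∈ spinZSector (Λ := TorusSite 2 M) 1 0 → ∀ σ, φ σ ≠ 0 → 0 < ψr σ) ∧
      (∀ φ : Config M → ℂ, IsGS M Δ φ → ∃ a : ℂ, ‖a‖ = 1 ∧ φ = a • ofReal M ψr) := by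
  have hW : ∃ σ : Config M, (∑ z, (σ z : ℕ)) = M ^ 2 / 2 :=
    exists_config_weight M (M ^ 2 / 2) (Nat.div_le_self _ _)
  obtain ⟨ψ₀, hK, hne, hnn, hpos, -, hH, huniq⟩ :=
    xxz_sector_perron_pos (torusGraph 2 M) (torusGraph_connected_of_proj 2 M) Δ (M ^ 2 / 2) hW
  have hlabel : ((Fintype.card (TorusSite 2 M) * 1 : ℕ) : ℝ) / 2 - ((M ^ 2 / 2 : ℕ) : ℝ) = 0 := by
    obtain ⟨k, rfl⟩ := hM
    have hk : (k + k) ^ 2 / 2 = 2 * k ^ 2 := by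
      rw [show (k + k) ^ 2 = 2 * (2 * k ^ 2) by ring, Nat.mul_div_cancel_left _ (by norm_num)]
    rw [show Fintype.card (TorusSite 2 (k + k)) = (k + k) ^ 2 by simp [Fintype.card_pi, ZMod.card], hk]
    push_cast
    ring
  have hweight : ∀ φ : Config M → ℂ, φ ∈ spinZSector (Λ := TorusSite 2 M) 1 0 →
      ∀ σ, (∑ z, (σ z : ℕ)) ≠ M ^ 2 / 2 → φ σ = 0 := by
    intro φ hφ
    have h := LiebMattis.mem_spinZSector_weight_iff (Λ := TorusSite 2 M) 1 (M ^ 2 / 2) φ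
    rw [hlabel] at h
    exact h.1 hφ
  rw [hlabel] at hK hH huniq
  -- normalise with a positive REAL scalar
  obtain ⟨c, hc0, hc1⟩ := exists_smul_unit hne
  have hr0 : 0 < ‖c‖ := norm_pos_iff.mpr hc0
  have hre : ∀ σ, ((ψ₀ σ).re : ℂ) = ψ₀ σ := fun σ =>
    Complex.ext (by simp) (by simp [(hnn σ).2])
  have hof : ofReal M (fun σ => ‖c‖ * (ψ₀ σ).re) = ((‖c‖ : ℝ) : ℂ) • ψ₀ := by
    funext σ
    simp only [ofReal, Pi.smul_apply, smul_eq_mul]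
    push_cast
    rw [hre]
  have hnorm1 : star (((‖c‖ : ℝ) : ℂ) • ψ₀) ⬝ᵥ (((‖c‖ : ℝ) : ℂ) • ψ₀) = 1 := by
    rw [star_smul_dotProduct_smul, ← hc1, star_smul_dotProduct_smul, Complex.norm_real,
      Real.norm_eq_abs, abs_of_pos hr0]
  refine ⟨fun σ => ‖c‖ * (ψ₀ σ).re, fun σ => mul_nonneg hr0.le (hnn σ).1, ?_, ?_, ?_⟩
  · -- sector ground state
    refine ⟨?_, ?_, ?_⟩
    · rw [hof]; exact Submodule.smul_mem _ _ hK
    · rw [hof]; exact hnorm1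
    · rw [hof, mulVec_smul, hH, smul_comm]
  · -- strict positivity on the support of the sector
    intro φ hφ σ hφσ
    have hw : (∑ z, (σ z : ℕ)) = M ^ 2 / 2 := by
      by_contra h
      exact hφσ (hweight φ hφ σ h)
    exact mul_pos hr0 (hpos σ hw)
  · -- every normalised sector ground state is a phase times `ψr`
    rintro φ ⟨hφK, hφ1, hφH⟩
    obtain ⟨c', rfl⟩ := huniq φ hφK hφH
    have hrc : ((‖c‖ : ℝ) : ℂ) ≠ 0 := by exact_mod_cast hr0.ne'
    refine ⟨c' / ((‖c‖ : ℝ) : ℂ), ?_, ?_⟩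
    · have h1 : ((‖c' / ((‖c‖ : ℝ) : ℂ)‖ ^ 2 : ℝ) : ℂ) = 1 := by
        have h := star_smul_dotProduct_smul (c' / ((‖c‖ : ℝ) : ℂ)) ((((‖c‖ : ℝ) : ℂ)) • ψ₀)
          ((((‖c‖ : ℝ) : ℂ)) • ψ₀)
        rw [hnorm1, mul_one, smul_smul, div_mul_cancel₀ _ hrc, hφ1] at h
        exact h.symm
      have h2 : ‖c' / ((‖c‖ : ℝ) : ℂ)‖ ^ 2 = 1 := by exact_mod_cast h1
      exact (pow_eq_one_iff_of_nonneg (norm_nonneg _) two_ne_zero).1 h2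
    · rw [hof, smul_smul, div_mul_cancel₀ _ hrc]

/-! ### Plan layer: the frozen-field ratio antitonicity reductions -/

/-- `Λ(φ) = ‖S⁻_tot φ‖² ≥ 0` (`S⁻_tot = (S⁺_tot)†`, `IsSu2Triple.star_M_mulVec_dotProduct`). [folklore] -/
theorem lam_nonneg (M : ℕ) [NeZero M] (φ : Config M → ℂ) : 0 ≤ lam M φ := by
  have hsu2 := isSu2Triple_on 1 (Finset.univ : Finset (TorusSite 2 M))
  have h : star φ ⬝ᵥ (Otot M *ᵥ φ) =
      star (lowerOn 1 Finset.univ *ᵥ φ) ⬝ᵥ (lowerOn 1 Finset.univ *ᵥ φ) := by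
    rw [hsu2.star_M_mulVec_dotProduct, mulVec_mulVec]
    rfl
  unfold lam
  rw [h, dotProduct, Complex.re_sum]
  refine Finset.sum_nonneg fun i _ => ?_
  rw [Pi.star_apply, Complex.star_def, mul_comm, Complex.mul_conj, Complex.ofReal_re]
  exact Complex.normSq_nonneg _

/-- `E_{ψ²}[g_ψ] = Λ(ψ)` for a real amplitude `ψ` (the field integrates back to the quadratic form; off the
support both sides vanish termwise). [folklore] -/
theorem sum_sq_mul_field_self (M : ℕ) [NeZero M] (ψ : Config M → ℝ) :
    ∑ σ, ψ σ ^ 2 * field M ψ σ = lam M (ofReal M ψ) := by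
  unfold lam field
  rw [dotProduct, Complex.re_sum]
  refine Finset.sum_congr rfl fun σ _ => ?_
  have hstar : (star (ofReal M ψ)) σ = (ψ σ : ℂ) := by
    simp [ofReal, Complex.conj_ofReal]
  rw [hstar, Complex.re_ofReal_mul]
  by_cases h : ψ σ = 0
  · simp [h]
  · field_simp

/-- `|ψ σ|² = ψ σ²` for a real amplitude. [folklore] -/
theorem norm_sq_ofReal (M : ℕ) (ψ : Config M → ℝ) (σ : Config M) :
    ‖ofReal M ψ σ‖ ^ 2 = ψ σ ^ 2 := by
  simp [ofReal, Complex.norm_real, Real.norm_eq_abs, sq_abs]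

/-- `|φ σ|² = ψr σ²` along a phase multiple `φ = a · ψr`, `|a| = 1`. [folklore] -/
theorem norm_sq_eq_of_phase (M : ℕ) (a : ℂ) (ha : ‖a‖ = 1) (ψr : Config M → ℝ) (σ : Config M) :
    ‖(a • ofReal M ψr) σ‖ ^ 2 = ψr σ ^ 2 := by
  simp [ofReal, Pi.smul_apply, smul_eq_mul, ha, Complex.norm_real, Real.norm_eq_abs, sq_abs]

/-- **REDUCTION B₁**: the FROZEN-FIELD RATIO ANTITONICITY (FFRA: for `-1 ≤ Δ ≤ s ≤ t ≤ 0` and the real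
non-negative sector ground states `ψ_Δ, ψ_s, ψ_t`, `(1+s)·E_{ψ_t²}[g_Δ] ≤ (1+t)·E_{ψ_s²}[g_Δ]`, taken as an
explicit hypothesis) implies the registered hardest stub `stub_frozenFieldChord` (take `s = Δ`, `t = 0`; `E_{ψΔ²}[g_Δ] = Λ(ψ_Δ)`; the XY law `|ψ₀|²` equals `ψ_0²`
for the Perron state `ψ_0` by phase uniqueness). -/
theorem frozenFieldChord_of_ratioAntitone
    (hR : (∀ (M : ℕ) [NeZero M], Even M → 4 ≤ M → ∀ (Δ s t : ℝ), -1 ≤ Δ → Δ ≤ s → s ≤ t → t ≤ 0 →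
      ∀ (ψΔ ψs ψt : Config M → ℝ),
        IsGS M Δ (ofReal M ψΔ) → (∀ σ, 0 ≤ ψΔ σ) →
        IsGS M s (ofReal M ψs) → (∀ σ, 0 ≤ ψs σ) →
        IsGS M t (ofReal M ψt) → (∀ σ, 0 ≤ ψt σ) →
          (1 + s) * (∑ σ, ψt σ ^ 2 * field M ψΔ σ) ≤ (1 + t) * (∑ σ, ψs σ ^ 2 * field M ψΔ σ))) :
    ∀ (M : ℕ) [NeZero M], Even M → 4 ≤ M → ∀ Δ ∈ Set.Icc (-1:ℝ) 0,
      ∀ (ψ₀ : Config M → ℂ) (ψ : Config M → ℝ),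
        IsGS M 0 ψ₀ → IsGS M Δ (ofReal M ψ) → (∀ σ, 0 ≤ ψ σ) →
          (1 + Δ) * (∑ σ, ‖ψ₀ σ‖ ^ 2 * field M ψ σ) ≤ lam M (ofReal M ψ) := by
  intro M _ hE h4 Δ hΔ ψ₀ ψ hGS₀ hGS hnn
  obtain ⟨ψr0, hnn0, hGS0, -, huniq0⟩ := sectorPerron_condensate M hE 0
  obtain ⟨a, ha1, hψa⟩ := huniq0 ψ₀ hGS₀
  have hlaw : ∀ σ, ‖ψ₀ σ‖ ^ 2 = ψr0 σ ^ 2 := fun σ => by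
    rw [hψa]; exact norm_sq_eq_of_phase M a ha1 ψr0 σ
  simp only [hlaw]
  have h := hR M hE h4 Δ Δ 0 hΔ.1 le_rfl hΔ.2 le_rfl ψ ψ ψr0 hGS hnn hGS hnn hGS0 hnn0
  rw [sum_sq_mul_field_self, add_zero, one_mul] at h
  exact h

/-- **REDUCTION B₂**: the LOCAL frozen-field ratio antitonicity (LFFRA: the same for `t - s ≤ δ(M, Δ, ψ_Δ)`,
taken as an explicit hypothesis; the integrated form of the first-order flow inequality FFI) chains along an equally spaced partition of the
pencil `[Δ, 0]` (mesh `≤ δ`, Perron states at the nodes from `sectorPerron_condensate`, all factors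
`1 + u ≥ 1 + Δ > 0`) to the hardest stub `stub_frozenFieldChord`; the endpoint `Δ = -1` is `0 ≤ Λ`. -/
theorem frozenFieldChord_of_localRatioAntitone
    (hL : (∀ (M : ℕ) [NeZero M], Even M → 4 ≤ M → ∀ Δ ∈ Set.Icc (-1:ℝ) 0, ∀ ψΔ : Config M → ℝ,
      IsGS M Δ (ofReal M ψΔ) → (∀ σ, 0 ≤ ψΔ σ) →
      ∃ δ : ℝ, 0 < δ ∧ ∀ (s t : ℝ), Δ ≤ s → s ≤ t → t ≤ 0 → t - s ≤ δ →
        ∀ (ψs ψt : Config M → ℝ),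
          IsGS M s (ofReal M ψs) → (∀ σ, 0 ≤ ψs σ) → IsGS M t (ofReal M ψt) → (∀ σ, 0 ≤ ψt σ) →
            (1 + s) * (∑ σ, ψt σ ^ 2 * field M ψΔ σ) ≤ (1 + t) * (∑ σ, ψs σ ^ 2 * field M ψΔ σ))) :
    ∀ (M : ℕ) [NeZero M], Even M → 4 ≤ M → ∀ Δ ∈ Set.Icc (-1:ℝ) 0,
      ∀ (ψ₀ : Config M → ℂ) (ψ : Config M → ℝ),
        IsGS M 0 ψ₀ → IsGS M Δ (ofReal M ψ) → (∀ σ, 0 ≤ ψ σ) →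
          (1 + Δ) * (∑ σ, ‖ψ₀ σ‖ ^ 2 * field M ψ σ) ≤ lam M (ofReal M ψ) := by
  intro M _ hE h4 Δ hΔ ψ₀ ψ hGS₀ hGS hnn
  rcases eq_or_lt_of_le hΔ.1 with hΔ1 | hΔ1
  · -- `Δ = -1`: the left side vanishes
    rw [← hΔ1, add_neg_cancel, zero_mul]
    exact lam_nonneg M _
  · -- `-1 < Δ`: chain the local inequality along `u_k = Δ + k h`, `h = -Δ/n ≤ δ`
    obtain ⟨δ, hδ, hstep⟩ := hL M hE h4 Δ hΔ ψ hGS hnn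
    choose pf hpf_nn hpf_GS _hpf_supp hpf_uniq using fun u : ℝ => sectorPerron_condensate M hE u
    have h1Δ : 0 < 1 + Δ := by linarith
    set n : ℕ := ⌈-Δ / δ⌉₊ + 1 with hn
    have hn0 : 0 < (n : ℝ) := by positivity
    set h : ℝ := -Δ / n with hh
    have hh0 : 0 ≤ h := div_nonneg (by linarith [hΔ.2]) hn0.le
    have hnh : Δ + (n : ℝ) * h = 0 := by
      rw [hh, mul_div_cancel₀ _ hn0.ne']
      ring
    have hhδ : h ≤ δ := by
      have h1 : -Δ / δ ≤ (n : ℝ) := by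
        have hc := Nat.le_ceil (-Δ / δ)
        rw [hn]
        push_cast
        linarith
      rw [hh, div_le_iff₀ hn0]
      have h2 := (div_le_iff₀ hδ).1 h1
      calc -Δ ≤ (n : ℝ) * δ := h2
        _ = δ * n := mul_comm _ _
    -- the frozen average along the pencil, evaluated at the chosen Perron states
    have hchain : ∀ k : ℕ, k ≤ n →
        (1 + Δ) * (∑ σ, pf (Δ + k * h) σ ^ 2 * field M ψ σ) ≤
          (1 + (Δ + k * h)) * (∑ σ, pf Δ σ ^ 2 * field M ψ σ) := by
      intro k
      induction k with
      | zero =>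
        intro _
        simp
      | succ k ih =>
        intro hk
        have IH := ih (Nat.le_of_succ_le hk)
        have hcast : ((k + 1 : ℕ) : ℝ) = (k : ℝ) + 1 := by push_cast; ring
        rw [hcast]
        have hk1 : (k : ℝ) + 1 ≤ n := by exact_mod_cast hk
        have hs : Δ ≤ Δ + k * h := by nlinarith
        have hst : Δ + k * h ≤ Δ + (k + 1) * h := by nlinarith
        have ht : Δ + (k + 1) * h ≤ 0 := by nlinarith
        have hts : Δ + (k + 1) * h - (Δ + k * h) ≤ δ := by nlinarith
        have step := hstep (Δ + k * h) (Δ + (k + 1) * h) hs hst ht hts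
          (pf (Δ + k * h)) (pf (Δ + (k + 1) * h))
          (hpf_GS _) (hpf_nn _) (hpf_GS _) (hpf_nn _)
        have h1s : 0 < 1 + (Δ + k * h) := by linarith
        have h1t : 0 ≤ 1 + (Δ + (k + 1) * h) := by linarith
        refine le_of_mul_le_mul_left ?_ h1s
        calc (1 + (Δ + k * h)) * ((1 + Δ) * ∑ σ, pf (Δ + (k + 1) * h) σ ^ 2 * field M ψ σ)
            = (1 + Δ) * ((1 + (Δ + k * h)) * ∑ σ, pf (Δ + (k + 1) * h) σ ^ 2 * field M ψ σ) := by
              ring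
          _ ≤ (1 + Δ) * ((1 + (Δ + (k + 1) * h)) * ∑ σ, pf (Δ + k * h) σ ^ 2 * field M ψ σ) :=
              mul_le_mul_of_nonneg_left step h1Δ.le
          _ = (1 + (Δ + (k + 1) * h)) * ((1 + Δ) * ∑ σ, pf (Δ + k * h) σ ^ 2 * field M ψ σ) := by
              ring
          _ ≤ (1 + (Δ + (k + 1) * h)) * ((1 + (Δ + k * h)) * ∑ σ, pf Δ σ ^ 2 * field M ψ σ) :=
              mul_le_mul_of_nonneg_left IH h1t
          _ = (1 + (Δ + k * h)) * ((1 + (Δ + (k + 1) * h)) * ∑ σ, pf Δ σ ^ 2 * field M ψ σ) := by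
              ring
    have hfin := hchain n le_rfl
    rw [hnh, add_zero, one_mul] at hfin
    -- identify the two end averages
    have hF0 : ∀ σ, pf 0 σ ^ 2 = ‖ψ₀ σ‖ ^ 2 := by
      intro σ
      obtain ⟨a, ha, hψa⟩ := hpf_uniq 0 ψ₀ hGS₀
      rw [hψa, norm_sq_eq_of_phase M a ha]
    have hFΔ : ∀ σ, pf Δ σ ^ 2 = ψ σ ^ 2 := by
      intro σ
      obtain ⟨a, ha, hψa⟩ := hpf_uniq Δ (ofReal M ψ) hGS
      rw [← norm_sq_ofReal M ψ σ, hψa, norm_sq_eq_of_phase M a ha]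
    simp only [hF0, hFΔ, sum_sq_mul_field_self] at hfin
    exact hfin


end Summit.HubbardSuperconductivity.HubbardSuperconductivity.Theorems.AnisotropyChord.DoobJohnsonChord

end
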